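import Literature.NumberTheory.GaloisRepresentations.PinnedDatumLabels
import Literature.NumberTheory.PAdicHodge.LabelledHodgeTateWeightsBaseChangeProofs
import HarnessLib

/-!
# Labelled Hodge–Tate weights at a label restrict along `E/F`, label by label (pinned data)

Topic `NumberTheory/GaloisRepresentations`; theorems only (no definition, no named fact), in the
vocabulary of `PinnedDatumLabels` (`PinnedLabel ℓ w hw`, `PinnedLabel.below`, `PinnedLabel.emb`,
`labelledHodgeTateWeightsAtLabel`) and `ToLocalRestrictField`
(`exists_toLocal_restrictField_eq_conj`: localising the restriction is restricting the
localisation up to a change of frame).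

For number fields `F ⊆ E`, a framed `ρ : Γ_F → GL_n(ℚ̄_ℓ)`, a place `w ∣ ℓ` of `E` and a label
`σ` of `E` at `w` (for THE pinned datum `fontainePstAdicCompletion w ℓ hw`):

  `HT_{(w, σ)}(ρ|_{Γ_E}) = HT_{(w ∩ 𝓞 F, σ|_{F_v})}(ρ)`   (`labelledHodgeTateWeightsAtLabel_restrictField_below`),

and, for a label `(v, τ)` of `F` below `(w, σ)` in the sense of global embeddings
(`σ.emb ∘ (F → E) = τ.emb`),

  `HT_{(w, σ)}(ρ|_{Γ_E}) = HT_{(v, τ)}(ρ)`   (`labelledHodgeTateWeightsAtLabel_restrictField_of_emb_comp_eq`).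

No de Rham hypothesis: this is the global, label-wise form of the tree's theorem
`PAdicHodge.LabelledWeightsRestrictSchema_holds` (Fontaine: `D_{dR,L}(V) = L ⊗_K D_{dR,K}(V)` as
filtered modules, read on the `τ''`-component; Patrikis §2.7.1 `HT_{τ''}(V|_{Γ_L}) = HT_{τ''|_K}(V)`),
transported to the places by `exists_toLocal_restrictField_eq_conj` and frame invariance
(`PstWeilDeligneData.labelledHodgeTateWeights_conj_eq`) — the label-wise sharpening of
`labelledHodgeTateWeightsAt_restrictField_eq_of_liesOver` (`ToLocalRestrictField`, which only
transports "all labels have weights `S`" and takes the local statement as a hypothesis).  It is the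
restriction step of Patrikis' induction formula `HT_{(v,τ)}(Ind_E^K W) = Σ_i HT_{(w_i,σ_i)}(W)`
(Lemma 7.2.1; tree's named fact `PAdicHodge.LabelledWeightsInduceSchema`).

## References

* [FontaineAsterisque223III] J.-M. Fontaine, *Représentations p-adiques semi-stables*, Astérisque 223
  (1994), Exp. III §1.5 and §3 (base change of `D_dR`).
* [BrinonConrad2009] O. Brinon, B. Conrad, *CMI Summer School notes on p-adic Hodge theory* (2009),
  Prop. 6.3.8.
* [Patrikis2019] S. Patrikis, *Variations on a theorem of Tate*, Mem. AMS 258 (2019), §2.7.1 and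
  Lemma 7.2.1.
* [SerreAbelianLadic1968] J.-P. Serre, *Abelian ℓ-adic representations and elliptic curves* (1968),
  Ch. I §2.1 (restriction to decomposition groups).
-/

noncomputable section

open scoped NumberField
open NumberField IsDedekindDomain Field ValuativeRel
open Literature.NumberTheory.PAdicHodge Literature.NumberTheory.Automorphic

namespace Literature.NumberTheory.GaloisRepresentations

variable {F E : Type} [Field F] [NumberField F] [Field E] [NumberField E] [Algebra F E]
  {ℓ : ℕ} [Fact ℓ.Prime] {n : ℕ}

/-- **Label-wise restriction at a pair of places `w ∣ v`, for THE pinned data**: for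
`ρ : Γ_F → GL_n(ℚ̄_ℓ)`, `w ∣ v` above `ℓ`, a label `τ''` of `E` at `w` and a label `τ'` of `F` at `v`
with `τ'' ∘ (F_v → E_w) = τ'` (the local base-change map `adicCompletionOfLiesOver`):
`HT_{(w,τ'')}(ρ|_{Γ_E}) = HT_{(v,τ')}(ρ)`.
[cite: FontaineAsterisque223III, Exp. III §1.5 and §3] [cite: Patrikis2019, §2.7.1]
[cite: SerreAbelianLadic1968, Ch. I §2.1] -/
theorem labelledHodgeTateWeightsAtLabel_restrictField_of_liesOver (ρ : FramedGaloisRep F (PadicAlgCl ℓ) n)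
    (v : HeightOneSpectrum (𝓞 F)) (w : HeightOneSpectrum (𝓞 E)) [w.asIdeal.LiesOver v.asIdeal]
    (hv : ((ℓ : ℕ) : 𝓞 F) ∈ v.asIdeal) (hw : ((ℓ : ℕ) : 𝓞 E) ∈ w.asIdeal)
    (τ' : PinnedLabel ℓ v hv) (τ'' : PinnedLabel ℓ w hw)
    (h : τ''.toHom.comp (adicCompletionOfLiesOver F E v w) = τ'.toHom) :
    labelledHodgeTateWeightsAtLabel (ρ.restrictField E) w hw τ'' =
      labelledHodgeTateWeightsAtLabel ρ v hv τ' := by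
  letI := (adicCompletionOfLiesOver F E v w).toAlgebra
  haveI := LocalField.charZero_adicCompletion v
  haveI := LocalField.charZero_adicCompletion w
  letI := (fontainePstAdicCompletion v ℓ hv).algebra
  letI := (fontainePstAdicCompletion w ℓ hw).algebra
  obtain ⟨g, hg⟩ := exists_toLocal_restrictField_eq_conj ρ v w
  -- the local, label-wise statement along `F_v → E_w`, applied to `ρ|_{Γ_{F_v}}`
  have key := LabelledWeightsRestrictSchema_holds ℓ (v.adicCompletion F) (w.adicCompletion E)
    (continuous_adicCompletionOfLiesOver F E v w)
    (LocalField.valuation_adicCompletion_natCast_lt_one v ℓ hv)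
    (LocalField.valuation_adicCompletion_natCast_lt_one w ℓ hw) n (ρ.toLocal v) τ' τ'' h
  dsimp only [labelledHodgeTateWeightsAtLabel]
  -- change of frame
  calc (ρ.restrictField E).labelledHodgeTateWeightsAt w (fontainePstAdicCompletion w ℓ hw).algebra
          (fontainePstAdicCompletion w ℓ hw).𝔅 τ''.toHom
      = (letI := (fontainePstAdicCompletion w ℓ hw).algebra
         (fontainePstAdicCompletion w ℓ hw).𝔅.labelledHodgeTateWeights
           (FramedRep.toContinuousRep ((ρ.toLocal v).comp
             (absGaloisRestrict (v.adicCompletion F) (w.adicCompletion E)))) τ''.toHom) := by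
        rw [FramedGaloisRep.labelledHodgeTateWeightsAt_def, hg]
        exact PstWeilDeligneData.labelledHodgeTateWeights_conj_eq _ (ρ g) _ τ''.toHom
    _ = ρ.labelledHodgeTateWeightsAt v (fontainePstAdicCompletion v ℓ hv).algebra
          (fontainePstAdicCompletion v ℓ hv).𝔅 τ'.toHom := by
        rw [FramedGaloisRep.labelledHodgeTateWeightsAt_def]
        exact key

/-- **`HT_{(w, σ)}(ρ|_{Γ_E}) = HT_{(w ∩ 𝓞 F, σ|_{F})}(ρ)`** — the labelled Hodge–Tate weights of the
restriction `ρ|_{Γ_E}` at a label `(w, σ)` of `E` are those of `ρ` at the label `σ.below F` of `F`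
below it (`PinnedLabel.below`: the place `w ∩ 𝓞 F` and the embedding `σ ∘ (F_v → E_w)`), for THE
pinned Fontaine data; no de Rham hypothesis.
[cite: FontaineAsterisque223III, Exp. III §1.5 and §3] [cite: BrinonConrad2009, Prop. 6.3.8]
[cite: Patrikis2019, §2.7.1] -/
theorem labelledHodgeTateWeightsAtLabel_restrictField_below (ρ : FramedGaloisRep F (PadicAlgCl ℓ) n)
    (w : HeightOneSpectrum (𝓞 E)) (hw : ((ℓ : ℕ) : 𝓞 E) ∈ w.asIdeal) (σ : PinnedLabel ℓ w hw) :
    labelledHodgeTateWeightsAtLabel (ρ.restrictField E) w hw σ =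
      labelledHodgeTateWeightsAtLabel ρ (w.under (𝓞 F)) (natCast_mem_under (F := F) hw)
        (σ.below F) := by
  haveI := liesOver_under (F := F) w
  exact labelledHodgeTateWeightsAtLabel_restrictField_of_liesOver ρ (w.under (𝓞 F)) w
    (natCast_mem_under (F := F) hw) hw (σ.below F) σ (PinnedLabel.toHom_below F σ).symm

/-- **`HT_{(w, σ)}(ρ|_{Γ_E}) = HT_{(v, τ)}(ρ)` for a label `(w, σ)` of `E` ABOVE a label `(v, τ)` of
`F`** in the sense of global embeddings, `σ.emb ∘ (F → E) = τ.emb` (then `w ∣ v` and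
`σ ∘ (F_v → E_w) = τ` by rigidity of pinned labels, `PinnedLabel.place_eq` / `eq_of_emb_eq`), for THE
pinned Fontaine data; no de Rham hypothesis.  Patrikis: `HT_{τ''}(V|_{Γ_L}) = HT_{τ''|_K}(V)`.
[cite: Patrikis2019, §2.7.1] [cite: FontaineAsterisque223III, Exp. III §1.5 and §3]
[cite: BrinonConrad2009, Prop. 6.3.8] -/
theorem labelledHodgeTateWeightsAtLabel_restrictField_of_emb_comp_eq
    (ρ : FramedGaloisRep F (PadicAlgCl ℓ) n) {v : HeightOneSpectrum (𝓞 F)}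
    {hv : ((ℓ : ℕ) : 𝓞 F) ∈ v.asIdeal} (τ : PinnedLabel ℓ v hv) {w : HeightOneSpectrum (𝓞 E)}
    {hw : ((ℓ : ℕ) : 𝓞 E) ∈ w.asIdeal} (σ : PinnedLabel ℓ w hw)
    (h : σ.emb.comp (algebraMap F E) = τ.emb) :
    labelledHodgeTateWeightsAtLabel (ρ.restrictField E) w hw σ =
      labelledHodgeTateWeightsAtLabel ρ v hv τ := by
  rw [labelledHodgeTateWeightsAtLabel_restrictField_below ρ w hw σ]
  exact labelledHodgeTateWeightsAtLabel_eq_of_emb_eq ρ (σ.below F) τ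
    (by rw [PinnedLabel.emb_below, h])

/-- The same for a family: if the labels `(w_i, σ_i)` of `E` all lie above `(v, τ)`, the labelled
weights of `ρ|_{Γ_E}` at every `(w_i, σ_i)` are `HT_{(v,τ)}(ρ)`; in particular their sum over
`i : Fin d` is `d • HT_{(v,τ)}(ρ)` (the case `W = ρ|_{Γ_E}` of Patrikis' induction formula, where
`Ind_E^F (ρ|_{Γ_E}) = ρ ⊗ Ind 1`). [cite: Patrikis2019, §2.7.1 and Lemma 7.2.1] -/
theorem sum_labelledHodgeTateWeightsAtLabel_restrictField_of_emb_comp_eq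
    (ρ : FramedGaloisRep F (PadicAlgCl ℓ) n) {v : HeightOneSpectrum (𝓞 F)}
    {hv : ((ℓ : ℕ) : 𝓞 F) ∈ v.asIdeal} (τ : PinnedLabel ℓ v hv) {d : ℕ}
    (w : Fin d → HeightOneSpectrum (𝓞 E)) (hw : ∀ i, ((ℓ : ℕ) : 𝓞 E) ∈ (w i).asIdeal)
    (σ : ∀ i, PinnedLabel ℓ (w i) (hw i)) (h : ∀ i, (σ i).emb.comp (algebraMap F E) = τ.emb) :
    ∑ i, labelledHodgeTateWeightsAtLabel (ρ.restrictField E) (w i) (hw i) (σ i) =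
      d • labelledHodgeTateWeightsAtLabel ρ v hv τ := by
  rw [Finset.sum_congr rfl fun i _ =>
    labelledHodgeTateWeightsAtLabel_restrictField_of_emb_comp_eq ρ τ (σ i) (h i),
    Finset.sum_const, Finset.card_univ, Fintype.card_fin]

end Literature.NumberTheory.GaloisRepresentations

end
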